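import Summits.HodgeConjecture.HodgeConjecture.Theorems.SignSymmetricPowersPencilTransport
import Literature.AlgebraicGeometry.Motives.GeneralNonsingularForms
import HarnessLib

/-!
# K1-B piece LINK-G, part (B1): forms under scaling, and the transport datum of a path
# (route `SignSymmetricPowers`, item stmt-HodgeConjecture-19716)

Line `andre-zariski`, skeleton v12f (`276eda50fce4ca90`); helper file for the registered stub
`stub_signConfluenceLinkG` (LINK-G), landed `--supports stmt-HodgeConjecture-19716`.  Notation as in
`SignSymmetricPowersPencilTransport`: `π : 𝒴_U → U` the universal family (`family`), `π_M : 𝒴_M → S_M` the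
`M`-supported subfamily (`familyM`), `g_M : S_M → U` (`toBase`), `B_t = tr_t ∘ ∪` the light trace form of the fibre
`𝒴_{M,t}`.

* §1 algebra of forms: `eval_smul_eq_pow_mul` (`f(c•x) = c^d f(x)`), `isOrdinaryDoublePointOf_smul`,
  `isNodalFormWithNodes_of_smul_nodes` (nodes may be rescaled by non-zero scalars), support lemmas.
* §2 **`exists_transportDatum`** — the TWO-LOOP form of the transport lemma
  `SignSymmetricPowersPencilTransport.exists_transport_picardLefschetz`: for a path `β : t ⇝ s` in `S_M(ℂ)` there are ONE
  linear map `Φ : Hⁿ(𝒴_{U, g_M s}) → Hⁿ(𝒴_{M,t})` and scalars `ρ, ν ≠ 0` WITH `ρ · ν = 1`, `B_t(Φv, Φw) = ν B(v, w)`,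
  such that EVERY loop `ω` at `s` whose image carries Picard–Lefschetz data `(δ, c)` of the universal family has
  its `π_M`-transport along `β·ω·β⁻¹` equal to `x ↦ x + (c ρ) Σᵢ B_t(x, Φδᵢ) Φδᵢ`.  Consequently the gauge-invariant
  products are preserved: `(cρ) · B_t(Φδᵢ, Φv) = c · B(δᵢ, v)` — which is what carries the `A₃` chain
  `c₀B(e₁,e₂) = ±1`, `c₀B(e₂,e₃) = ±1` of F-B2PL to a base point (`SignSymmetricPowersLinkConfluence`).

Sorry-free; axioms `propext`, `Classical.choice`, `Quot.sound`; no definition, no named fact.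

## References

* [VoisinHodgeII2003] C. Voisin, Hodge Theory and Complex Algebraic Geometry II (CUP 2003), §2.3.1, §3.1.2, §3.2.1
  Thm. 3.16, §3.2.2, §6.2.1.
* [HatcherAT2002] A. Hatcher, Algebraic Topology (CUP 2002), §3.3 Thm. 3.26.
-/

noncomputable section

set_option linter.dupNamespace false

open CategoryTheory AlgebraicGeometry MvPolynomial
open scoped unitInterval
open Literature.AlgebraicTopology.SingularHomology
open Literature.AlgebraicGeometry.Motives Literature.AlgebraicGeometry.Motives.UniversalHypersurface
open Literature.AlgebraicGeometry.HodgeTheory Literature.AlgebraicGeometry.HodgeTheory.UniversalHypersurface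
open Literature.AlgebraicGeometry.HodgeTheory.BettiUniverse
open Summit.HodgeConjecture.HodgeConjecture.Theorems.SignSymmetricPowersPencilTransport

namespace Summit.HodgeConjecture.HodgeConjecture.Theorems.SignSymmetricPowersLinkTransport

/-! ### §1 Forms: scaling the argument, rescaling nodes, supports -/

section Forms

variable {N : ℕ}

/-- A form of degree `d` is homogeneous under scaling of the argument: `f(c • x) = c^d · f(x)`. [folklore] -/
theorem eval_smul_eq_pow_mul (f : MvPolynomial (Fin N) ℂ) {d : ℕ} (hf : f.IsHomogeneous d) (c : ℂ)
    (x : Fin N → ℂ) : eval (c • x) f = c ^ d * eval x f := by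
  rw [eval_eq', eval_eq', Finset.mul_sum]
  refine Finset.sum_congr rfl fun α hα => ?_
  have hdeg : ∑ i, α i = d := by
    rw [← Finsupp.degree_eq_sum, Finsupp.degree_apply]
    exact (hf.degree_eq_sum_deg_support hα).symm
  simp_rw [Pi.smul_apply, smul_eq_mul, mul_pow, Finset.prod_mul_distrib, Finset.prod_pow_eq_pow_sum, hdeg]
  ring

variable {n : ℕ}

/-- An ordinary double point stays one after rescaling its coordinate vector (the form being homogeneous).
[cite: VoisinHodgeII2003, §2.3.1] -/
theorem isOrdinaryDoublePointOf_smul {f : MvPolynomial (Fin (n + 2)) ℂ} {d : ℕ} (hf : f.IsHomogeneous d)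
    {p : Fin (n + 2) → ℂ} (h : IsOrdinaryDoublePointOf f p) {c : ℂ} (hc : c ≠ 0) :
    IsOrdinaryDoublePointOf f (c • p) := by
  refine ⟨smul_ne_zero hc h.ne_zero, fun j => ?_, ?_⟩
  · rw [eval_smul_eq_pow_mul _ hf.pderiv, h.eval_pderiv j, mul_zero]
  · have hmat : (Matrix.of fun i j : Fin (n + 2) => eval (c • p) (pderiv i (pderiv j f))) =
        Matrix.diagonal (fun _ : Fin (n + 2) => c ^ (d - 1 - 1)) *
          Matrix.of fun i j : Fin (n + 2) => eval p (pderiv i (pderiv j f)) := by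
      rw [← Matrix.smul_eq_diagonal_mul]
      ext i j
      simp only [Matrix.of_apply, Matrix.smul_apply, smul_eq_mul]
      exact eval_smul_eq_pow_mul _ (hf.pderiv.pderiv) c p
    rw [hmat, Matrix.rank_mul_eq_right_of_isUnit_det _ _ (by
      rw [Matrix.det_diagonal, Finset.prod_const]
      exact (isUnit_iff_ne_zero.2 (pow_ne_zero _ hc)).pow _), h.rank_hessian]

/-- **Nodes may be rescaled**: if `f` (homogeneous) is nodal with nodes `p₁, …, p_k` and `p'ᵢ = cᵢ • pᵢ` with
`cᵢ ≠ 0`, then `f` is nodal with nodes `p'₁, …, p'_k` (the predicate only sees the points `[pᵢ] ∈ ℙⁿ⁺¹`).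
[cite: VoisinHodgeII2003, §2.3.1] -/
theorem isNodalFormWithNodes_of_smul_nodes {k : ℕ} {f : MvPolynomial (Fin (n + 2)) ℂ} {d : ℕ}
    (hf : f.IsHomogeneous d) {p p' : Fin k → Fin (n + 2) → ℂ} (h : IsNodalFormWithNodes f p)
    (c : Fin k → ℂ) (hc : ∀ i, c i ≠ 0) (hp' : ∀ i, p' i = c i • p i) : IsNodalFormWithNodes f p' := by
  obtain ⟨hodp, hdist, hall⟩ := h
  refine ⟨fun i => by rw [hp' i]; exact isOrdinaryDoublePointOf_smul hf (hodp i) (hc i), fun i i' ⟨t, ht⟩ => ?_,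
    fun z hz hgrad => ?_⟩
  · refine hdist i i' ⟨(c i)⁻¹ * t * c i', ?_⟩
    rw [hp' i, hp' i'] at ht
    have := congrArg (fun v => (c i)⁻¹ • v) ht
    simp only [smul_smul, inv_mul_cancel₀ (hc i), one_smul] at this
    rw [this, mul_assoc]
  · obtain ⟨i, t, ht⟩ := hall z hz hgrad
    exact ⟨i, t * (c i)⁻¹, by rw [hp' i, smul_smul, mul_assoc, inv_mul_cancel₀ (hc i), mul_one, ht]⟩

variable {d : ℕ} {M : Set (DegIndex n d)}

/-- Sums of `M`-supported forms are `M`-supported. [folklore] -/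
theorem isSupportedOn_add {f g : MvPolynomial (Fin (n + 2)) ℂ} (hf : IsSupportedOn n d M f)
    (hg : IsSupportedOn n d M g) : IsSupportedOn n d M (f + g) := fun m hm => by
  rw [coeff_add, hf m hm, hg m hm, add_zero]

/-- Scalar multiples of `M`-supported forms are `M`-supported. [folklore] -/
theorem isSupportedOn_smul {f : MvPolynomial (Fin (n + 2)) ℂ} (hf : IsSupportedOn n d M f) (c : ℂ) :
    IsSupportedOn n d M (c • f) := fun m hm => by
  rw [coeff_smul, hf m hm, smul_zero]

end Forms

/-! ### §2 The transport datum of a path -/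

section Transport

variable (n d : ℕ) (M : Set (DegIndex n d)) (γ : Fin (n + 2) → ℂˣ)

/-- **Transport datum of a path (two-loop transport lemma).**  Let `n, d ≥ 1`, `γ` fix the monomials of `M`,
and `β : t ⇝ s` a path in `S_M(ℂ)`.  There are a linear map `Φ : Hⁿ(𝒴_{U, g_M s}; ℚ) → Hⁿ(𝒴_{M,t}; ℚ)` (namely
`T_β⁻¹ ∘ e_s^*`, `e_s = fiberIsoM s`) and scalars `ρ, ν ≠ 0` with `ρ ν = 1`, such that `B_t(Φ v, Φ w) = ν B(v, w)`,
`σ_{γ,t}^*(Φ v) = Φ(σ'^* v)` for `σ' = e_s⁻¹ ≫ σ_{γ,s} ≫ e_s`, and for EVERY loop `ω` at `s` whose image in `U(ℂ)`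
carries Picard–Lefschetz data `(δ, c)` of the universal family, the rational transport of `π_M` along `β · ω · β⁻¹`
exists and equals `x ↦ x + (c ρ) Σᵢ B_t(x, Φ δᵢ) Φ δᵢ`.  Since `ρ ν = 1`, the products `c · B(δᵢ, v)` are preserved:
`(c ρ) B_t(Φ δᵢ, Φ v) = c B(δᵢ, v)`.  (Same proof as `exists_transport_picardLefschetz`, with the datum shared by
all loops at `s` and the relation `ρ ν = 1` — from `(e_s⁻¹)^* ∘ e_s^* = id` on the top cohomology — recorded.)
[cite: VoisinHodgeII2003, §3.1.2 and §3.2.2 (construction of δ_γ by transport)] -/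
theorem exists_transportDatum (hn : 1 ≤ n) (hd : 1 ≤ d) (hγ : FixesMonomials ℂ n d M γ)
    (hUU : IsCohomologicallyLocallyTrivialOn (family ℂ n d) Set.univ)
    (hU : IsCohomologicallyLocallyTrivialOn (familyM ℂ n d M) Set.univ)
    {t s : ComplexPoints (baseM ℂ n d M)} (β : Path t s) :
    ∃ (Φ : bettiCohomology (fiberOver (family ℂ n d) (AlgPoints.map (toBase ℂ n d M) s)) n →ₗ[ℚ]
        bettiCohomology (fiberOver (familyM ℂ n d M) t) n) (ρ ν : ℚ),
      ρ ≠ 0 ∧ ν ≠ 0 ∧ ρ * ν = 1 ∧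
      (∀ v w, tr (isSmoothProjective_fiberOver_familyM ℂ n d M hn hd t) (n + n)
            (cup (fiberOver (familyM ℂ n d M) t) n n (Φ v) (Φ w)) =
          ν * tr ((isSmoothProjectiveFamily_family ℂ hn hd).isSmoothProjective _) (n + n)
            (cup (fiberOver (family ℂ n d) (AlgPoints.map (toBase ℂ n d M) s)) n n v w)) ∧
      (∀ v, pull (sigmaMFiber ℂ n d M γ hγ t) n (Φ v) =
        Φ (pull ((fiberIsoM ℂ n d M s).inv ≫ sigmaMFiber ℂ n d M γ hγ s ≫ (fiberIsoM ℂ n d M s).hom) n v)) ∧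
      ∀ (k : ℕ) (ω : Path s s)
        (δ : Fin k → bettiCohomology (fiberOver (family ℂ n d) (AlgPoints.map (toBase ℂ n d M) s)) n) (c : ℚ),
        IsPicardLefschetzData n d k hn hd hUU (ω.map (AlgPoints.mapContinuous (toBase ℂ n d M)).continuous) δ c →
        ∃ T : bettiCohomology (fiberOver (familyM ℂ n d M) t) n ≃ₗ[ℚ] bettiCohomology (fiberOver (familyM ℂ n d M) t) n,
          IsRatTransport (familyM ℂ n d M) n hU ⟦((β.trans ω).trans β.symm).map
            (⟨fun s => ⟨s, Set.mem_univ s⟩, continuous_id.subtype_mk _⟩ :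
              C(ComplexPoints (baseM ℂ n d M), (Set.univ : Set (ComplexPoints (baseM ℂ n d M))))).continuous⟧ T ∧
          ∀ x, T x = x + (c * ρ) • ∑ i,
            tr (isSmoothProjective_fiberOver_familyM ℂ n d M hn hd t) (n + n)
              (cup (fiberOver (familyM ℂ n d M) t) n n x (Φ (δ i))) • Φ (δ i) := by
  -- notation
  set toU : C(ComplexPoints (baseM ℂ n d M), (Set.univ : Set (ComplexPoints (baseM ℂ n d M)))) :=
    ⟨fun s => ⟨s, Set.mem_univ s⟩, continuous_id.subtype_mk _⟩ with htoU
  set e := fiberIsoM ℂ n d M s with he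
  have hYt : IsSmoothProjective n (fiberOver (familyM ℂ n d M) t) :=
    isSmoothProjective_fiberOver_familyM ℂ n d M hn hd t
  have hYs : IsSmoothProjective n (fiberOver (familyM ℂ n d M) s) :=
    isSmoothProjective_fiberOver_familyM ℂ n d M hn hd s
  have hYU : IsSmoothProjective n (fiberOver (family ℂ n d) (AlgPoints.map (toBase ℂ n d M) s)) :=
    (isSmoothProjectiveFamily_family ℂ hn hd).isSmoothProjective _
  have hrat := fun (a b : (Set.univ : Set (ComplexPoints (baseM ℂ n d M)))) (δ' : Path.Homotopic.Quotient a b)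
      (α : complexBetti (fiberOver (familyM ℂ n d M) a.1) n) (hα : IsRationalClass α) =>
    isRationalClass_transportFun_familyM n d M hn hd n hU δ' hα
  have hrat2 := fun (a b : (Set.univ : Set (ComplexPoints (baseM ℂ n d M)))) (δ' : Path.Homotopic.Quotient a b)
      (α : complexBetti (fiberOver (familyM ℂ n d M) a.1) (n + n)) (hα : IsRationalClass α) =>
    isRationalClass_transportFun_familyM n d M hn hd (n + n) hU δ' hα
  -- the transports along `β`
  obtain ⟨Tβ, hTβ⟩ : ∃ Tβ, IsRatTransport (familyM ℂ n d M) n hU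
      (⟦β.map toU.continuous⟧ : Path.Homotopic.Quotient (toU t) (toU s)) Tβ :=
    exists_ratTransport (familyM ℂ n d M) n hU hrat _
  obtain ⟨Tβ2, hTβ2⟩ : ∃ Tβ2, IsRatTransport (familyM ℂ n d M) (n + n) hU
      (⟦β.map toU.continuous⟧ : Path.Homotopic.Quotient (toU t) (toU s)) Tβ2 :=
    exists_ratTransport (familyM ℂ n d M) (n + n) hU hrat2 _
  -- the similitude scalars
  obtain ⟨lam, hlam, hlame⟩ := exists_tr_comp_pull_eq_mul_of_iso hYU hYs e.symm
  obtain ⟨lam2, hlam2, hlam2e⟩ := exists_tr_comp_pull_eq_mul_of_iso hYs hYU e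
  obtain ⟨μ, hμ, hμe⟩ := exists_tr_cup_ratTransport_eq_mul (familyM ℂ n d M) hU (s := toU t)
    (t := toU s) hYt hYs _ hTβ hTβ2
  have hμe' : ∀ a b : bettiCohomology (fiberOver (familyM ℂ n d M) t) n,
      tr hYs (n + n) (cup (fiberOver (familyM ℂ n d M) s) n n (Tβ a) (Tβ b)) =
        μ * tr hYt (n + n) (cup (fiberOver (familyM ℂ n d M) t) n n a b) := hμe
  have hlame' : ∀ z : bettiCohomology (fiberOver (familyM ℂ n d M) s) (n + n),
      tr hYU (n + n) (pull e.inv (n + n) z) = lam * tr hYs (n + n) z := fun z => hlame (n + n) z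
  -- `lam * lam2 = 1`
  have hll : lam * lam2 = 1 := by
    have htr : tr hYU (n + n) ≠ 0 := by rw [← two_mul]; exact tr_top_ne_zero hYU
    obtain ⟨z, hz⟩ : ∃ z, tr hYU (n + n) z ≠ 0 := by
      by_contra hall
      push Not at hall
      exact htr (LinearMap.ext hall)
    have h1 : tr hYU (n + n) z = lam * lam2 * tr hYU (n + n) z := by
      conv_lhs => rw [← pull_inv_pull_hom_apply e (n + n) z, hlame', hlam2e]
      ring
    have h2 : (lam * lam2 - 1) * tr hYU (n + n) z = 0 := by linear_combination -h1
    rcases mul_eq_zero.1 h2 with h | h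
    · linear_combination h
    · exact absurd h hz
  -- (2) `Φ` is a similitude
  have hsim : ∀ v w, tr hYt (n + n) (cup (fiberOver (familyM ℂ n d M) t) n n (Tβ.symm (pull e.hom n v))
      (Tβ.symm (pull e.hom n w))) = (μ⁻¹ * lam2) * tr hYU (n + n)
        (cup (fiberOver (family ℂ n d) (AlgPoints.map (toBase ℂ n d M) s)) n n v w) := fun v w => by
    have h := hμe' (Tβ.symm (pull e.hom n v)) (Tβ.symm (pull e.hom n w))
    rw [LinearEquiv.apply_symm_apply, LinearEquiv.apply_symm_apply, ← pull_cup, hlam2e] at h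
    rw [mul_assoc, h, ← mul_assoc, inv_mul_cancel₀ hμ, one_mul]
  -- (3) `Φ` intertwines `σ_t^*` with `σ'^*`
  have hequi : ∀ v, pull (sigmaMFiber ℂ n d M γ hγ t) n (Tβ.symm (pull e.hom n v)) =
      Tβ.symm (pull e.hom n (pull (e.inv ≫ sigmaMFiber ℂ n d M γ hγ s ≫ e.hom) n v)) := fun v => by
    have h := isRatTransport_map_pull_sigmaMFiber n d M γ n hU hγ (hTβ.symm (familyM ℂ n d M) n hU)
      (pull e.hom n v)
    rw [pull_comp, pull_comp, LinearMap.comp_apply, LinearMap.comp_apply, pull_hom_pull_inv_apply]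
    exact h.symm
  refine ⟨Tβ.symm.toLinearMap ∘ₗ pull e.hom n, lam * μ, μ⁻¹ * lam2, mul_ne_zero hlam hμ,
    mul_ne_zero (inv_ne_zero hμ) hlam2, ?_, hsim, hequi, fun k ω δ c hPL => ?_⟩
  · rw [show lam * μ * (μ⁻¹ * lam2) = lam * lam2 * (μ * μ⁻¹) by ring, mul_inv_cancel₀ hμ, mul_one, hll]
  -- (1) the transport along `β · ω · β⁻¹` of a Picard–Lefschetz loop
  obtain ⟨TU, hTU, hTUx⟩ := hPL.2.2.1
  have hTM : IsRatTransport (familyM ℂ n d M) n hU ⟦ω.map toU.continuous⟧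
      (pullEquiv e n ≪≫ₗ TU ≪≫ₗ (pullEquiv e n).symm) :=
    isRatTransport_familyM_of_family n d M n hUU hU (ω.map toU.continuous)
      ((ω.map (AlgPoints.mapContinuous (toBase ℂ n d M)).continuous).map (toUniv n d).continuous)
      (fun _ => rfl) hTU
  have hT' : IsRatTransport (familyM ℂ n d M) n hU ⟦((β.trans ω).trans β.symm).map toU.continuous⟧
      (Tβ ≪≫ₗ (pullEquiv e n ≪≫ₗ TU ≪≫ₗ (pullEquiv e n).symm) ≪≫ₗ Tβ.symm) := by
    rw [Path.map_trans, Path.map_trans, ← Path.map_symm]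
    exact ((hTβ.trans (familyM ℂ n d M) n hU hTM).trans (familyM ℂ n d M) n hU
      (hTβ.symm (familyM ℂ n d M) n hU))
  have hTUx' : ∀ y : bettiCohomology (fiberOver (family ℂ n d) (AlgPoints.map (toBase ℂ n d M) s)) n,
      TU y = y + c • ∑ i, tr hYU (n + n)
        (cup (fiberOver (family ℂ n d) (AlgPoints.map (toBase ℂ n d M) s)) n n y (δ i)) • δ i := hTUx
  refine ⟨_, hT', fun x => ?_⟩
  change Tβ.symm (pull e.hom n (TU (pull e.inv n (Tβ x)))) = _
  rw [hTUx', map_add, map_add, pull_hom_pull_inv_apply, LinearEquiv.symm_apply_apply, map_smul,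
    map_smul, map_sum, map_sum, ← smul_smul c (lam * μ), Finset.smul_sum (r := lam * μ)]
  congr 2
  refine Finset.sum_congr rfl fun i _ => ?_
  rw [map_smul, map_smul, smul_smul]
  congr 1
  simp only [LinearMap.coe_comp, Function.comp_apply, LinearEquiv.coe_coe]
  set r := Tβ.symm (pull e.hom n (δ i)) with hr
  have h1 : δ i = pull e.inv n (pull e.hom n (δ i)) := (pull_inv_pull_hom_apply e n (δ i)).symm
  have h2 : pull e.hom n (δ i) = Tβ r := by rw [hr, LinearEquiv.apply_symm_apply]
  conv_lhs => rw [h1, ← pull_cup, hlame', h2, hμe']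
  ring

end Transport

end Summit.HodgeConjecture.HodgeConjecture.Theorems.SignSymmetricPowersLinkTransport

end
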